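import Literature.MathematicalPhysics.QuantumFieldTheory.Balaban1983to89.B2Prop22Proof
import Literature.MathematicalPhysics.QuantumFieldTheory.Balaban1983to89.B4ThmZeroNestAlphaZero

/-!
# `Balaban1983to89.B2Prop22ZeroField` — T. Bałaban, *(Higgs)₂,₃ quantum fields in a finite volume. II. An upper bound*,
# Commun. Math. Phys. **86** (1982) 555–594 [Balaban1982Higgs2]: **Proposition 2.2** (2.58) pp. 570–571, r14's decl of
# record `…B2StepK.Prop22Printed`, PROVED WITH NO HYPOTHESIS on the MODEL INSTANCE `A = 0` over the nested boxes of the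
# B4 cell — the dictionary of `…B2Prop22Proof` §1 instantiated, its hypotheses discharged, Prop. I.2.1's α = 0 clause
# taken from the B4 sub-cell's PROVED `…B4ThmZeroNestAlphaZero.ineq_zero_nestFamB`

statement-level skeleton of published theorems with citation tags; proofs where landed; nothing here is a claim about the Yang–Mills mass gap

PDF held: `paper:balaban1982-cmp86-higgs23-ii` (journal page = PDF page + 554); II pp. 570–571 read as images on
`run/shared/lean/pub/pub-balaban/b2b-balaban-ref1/pages/1982-cmp86-higgs23-II/1982-cmp86-higgs23-II-p016-x2.png`, `…-p017-x2.png`;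
I pp. 607–610 on `…/1982-cmp85-higgs23-I/1982-cmp85-higgs23-I-p005-x2.png`, `…-p008-x2.png`.

CITATION HEADER (lean-in-tree rule).  Cell `lit-balaban` (HOME `run/shared/lean/pub/lit-balaban/`), Phase-2 proof seat
**p17** gen 2 (unit `lit-balaban-p17-g2`); SKELETON row **B2.Prop2.2**, kind «model instance» (PHASE2-TARGETS §G.1) —
companion of `…B2Prop22Proof` (the knitting Prop. 2.2 ⇐ Prop. I.2.1 over the dictionary `f_{y,v} = Q_k^*(A)(vδ_y)`).
USED BY NAME, never restated: `…B2StepK.Prop22Printed` (r14 p239461), `…B2Prop22Proof.Dict` / `prop22Printed_of_B4clause`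
/ `bound_plain` (this seat), and the B4 sub-cell's zero-field lineage (pub-balaban b04/pv17, files untouched):
`…B4Cor23ZeroEta.ZeroFieldInstance` / `zeroFieldSettingB` (b04's verbatim carrier of `B4.EtaSetting` at `A = 0`),
`…B4Ineq111ZeroNestEta.NestInst` / `nestFamB` (the nested-box family), `…B4ThmZeroNestAlphaZero.ineq_zero_nestFamB`
((1.9)–(1.12) at `α = 0` on that family, one pair of constants, every threshold `R₀`, no antecedent), the distances
`…B4Lower18.edistR` (η-scaled sup-distance), `…B4Cor23ZeroDelta.setDist` / `bdist` / `outR`, `…B4Cor23Zero.supp`.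

WHAT IS PRINTED (verbatim, II pp. 570–571): *"**Proposition 2.2.** Let Ω and A satisfy the assumptions of Proposition
I.2.1, then for e(L^kε) sufficiently small there exist positive constants δ₀, c₀, R₀ independent of A, k, Ω and
depending on d, a, M, such that |(D^η_AG_k(Ω, A)Q_k^*(A))(b, y)| ≦ c₀ exp(−δ₀ dist(b, y)),  (2.58)  for b ⊂ Ω,
dist(b, Ωᶜ) ≧ R₀, y ∈ Ω^{(k)}. The identical inequality holds for G_k(Ω, A)Q_k^*(A), and for D^η_AδG_k(Ω,Ω₀, A)Q_k^*(A),
δG_k(Ω,Ω₀, A)Q_k^*(A) with the additional factor exp(−δ₀(dist(b,Ωᶜ) + dist(y,Ωᶜ))).  This proposition is a simple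
corollary of Proposition I.2.1."*  At `A = 0` (I p. 605 `U(0) = 1`, I (2.11)/(2.20) weight-1 adjoint): `Q_k^*δ_y =
1_{B^k(y)}`, the indicator of the block `B^k(y) = {x : ⌊x/L^k⌋ = y}` (I (1.17) `B(y) = {x : y_μ ≦ x_μ < y_μ + L}`), so
`(G_k(Ω,0)Q_k^*)(x,y) = Σ_{x′∈B^k(y)} G_k(Ω,0;x,x′)`.

WHAT IS PROVED (kernel-checked, zero `sorry`, no new `def … : Prop`; axioms standard).  THE MODEL (`zeroDict`): member
`i` of the nested-box family (scale `k ≥ 1`, `η = L^{−k}`, `L = ℓ + 1 ≥ 2`, box `Ω = Π_j[0,M_j)` inside a translated box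
`Ω₀`, mass `m² ∈ [0, m²₊]`, `a > 0`, big-block size `Mb`, boundary assignment `dist_η(supp f, Ω₀∖Ω)`): the Prop. I.2.1
instance is b04's `nestFamB … i`; `y ∈ Π_j[0,M_j) ∩ ℤ^{d+1}`; bonds `(b₋, μ)` read at `b₋`; one test vector (`N = 1`,
`A = 0`); `f_y = 1_{B^k(y)}` (`blockInd`); `dist(x, y) := η|x − L^ky|_∞` (`corner` = `L^ky`, the base corner of `B^k(y)`
as a point of `T_η`), `dist(y, Ωᶜ) := dist_η(L^ky, Ω₀∖Ω)`; allowance `D = 1`.  THE DICTIONARY FACTS, PROVED: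
`supNorm_blockInd_le` (`‖1_{B^k(y)}‖_∞ ≤ 1`), `dxy_le_sdist` (`dist(x,y) ≤ dist(x, supp 1_{B^k(y)}) + 1`, sup-metric
triangle inequality + block diameter `(L^k − 1)η < 1`), `ydist_le_bdist` (`dist(y,Ωᶜ) ≤ dist(supp 1_{B^k(y)}, Ωᶜ) + 1`).
THE RESULTS: **`prop22Printed_zero_nestFam`** — `B2StepK.Prop22Printed (fun i => (zeroDict … i).toP22)` for every
`L ≥ 2`, `a > 0`, `m²₊`, `Mb`, NO hypothesis (the typed antecedents `regular`, `bigBlocks`, `0 < e ≤ e₁` are not used);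
`kGQ_zeroDict` (the linked kernel IS `|Σ_{x′∈B^k(y)} G_k(Ω,0;x,x′)|`, `G_k(Ω,0)` = b04's `green` =
`(−Δ^{η,N}_Ω + m² + aP_k)⁻¹`); the explicit form **`GQ_decay_zero_nestFam`**: one pair `δ₀, c₀ > 0` with
`|Σ_{x′∈B^k(y)} G_k(Ω,0;x,x′)| ≤ c₀e^{−δ₀η|x − L^ky|_∞}` for every member, EVERY `x ∈ Ω` (no boundary restriction: the
B4 clause holds for every threshold) and every `y ∈ Ω^{(k)}`.
NOT CLAIMED: anything at `A ≠ 0` (no concrete `EtaSetting` with a gauge field exists in the tree; `…B2Prop22Proof` §2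
has the two dictionary facts for the genuine `Q_k^*(A)`); Prop. I.2.1 beyond the B4 cell's zero-field theorem.
-/

namespace Literature.MathematicalPhysics.QuantumFieldTheory.Balaban1983to89.B2Prop22ZeroField

open Literature.MathematicalPhysics.QuantumFieldTheory.Balaban1983to89
open Literature.MathematicalPhysics.QuantumFieldTheory.Balaban1983to89.B2Prop22Proof (Dict bound_plain
  prop22Printed_of_B4clause)

open Literature.MathematicalPhysics.QuantumFieldTheory.Balaban1983to89.B4Reflection242 (boxDom mem_boxDom blk blk_mul)
open Literature.MathematicalPhysics.QuantumFieldTheory.Balaban1983to89.B4Lower18 (edistR)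
open Literature.MathematicalPhysics.QuantumFieldTheory.Balaban1983to89.B4Cor23Zero (supp edistR_comm edistR_triangle)
open Literature.MathematicalPhysics.QuantumFieldTheory.Balaban1983to89.B4Cor23ZeroDelta (setDist setDist_le outR bdist inclEmb edistR_incl)
open Literature.MathematicalPhysics.QuantumFieldTheory.Balaban1983to89.B4TwoRegion120 (incl)
open Literature.MathematicalPhysics.QuantumFieldTheory.Balaban1983to89.B4Cor23ZeroEta (ZeroFieldInstance)
open Literature.MathematicalPhysics.QuantumFieldTheory.Balaban1983to89.B4Ineq19ZeroBoxEta (BoxInst)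
open Literature.MathematicalPhysics.QuantumFieldTheory.Balaban1983to89.B4Ineq111ZeroNestEta (NestInst nestFamB)
open Literature.MathematicalPhysics.QuantumFieldTheory.Balaban1983to89.B4ThmZeroNestAlphaZero (ineq_zero_nestFamB)
open Literature.MathematicalPhysics.QuantumFieldTheory.Balaban1983to89.B4Thm19ZeroBoxNegAlpha (supN_le_of_forall_le)
open Literature.MathematicalPhysics.QuantumFieldTheory.Balaban1983to89.B4BoxCov237 (supNorm_sub_le_of_blk_eq)

noncomputable section

variable {d ℓ : ℕ} {m2plus : ℝ}

/-! ## §1. Set-distance helpers -/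

/-- a lower bound shared by all pairwise distances is a lower bound of the set distance (nonempty product). [folklore] -/
private theorem le_setDist {α : Type*} (dR : α → α → ℝ) {A B : Finset α} (hne : (A ×ˢ B).Nonempty) {c : ℝ}
    (h : ∀ a ∈ A, ∀ b ∈ B, c ≤ dR a b) : c ≤ setDist dR A B := by
  unfold setDist
  rw [dif_pos hne]
  exact Finset.le_inf' hne _ fun p hp => by
    obtain ⟨ha, hb⟩ := Finset.mem_product.1 hp
    exact h _ ha _ hb

/-- the set distance to the empty set is the junk value `0`. [folklore] -/
private theorem setDist_empty_right {α : Type*} (dR : α → α → ℝ) (A : Finset α) : setDist dR A ∅ = 0 := by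
  unfold setDist
  rw [dif_neg]
  simp

/-- two fine points of one `n`-block are at η-distance `≤ (n − 1)/n ≤ 1`. [folklore] -/
private theorem edistR_le_one_of_blk {n : ℕ} (hn : 1 ≤ n) {R : Finset (Fin (d + 1) → ℤ)} (x x' : ↥R)
    (h : blk n x.1 = blk n x'.1) : edistR n R x x' ≤ 1 := by
  have hn0 : (0 : ℝ) < n := by exact_mod_cast hn
  show (1 / (n : ℝ)) * B4ContourShift.supNorm (x.1 - x'.1) ≤ 1
  calc (1 / (n : ℝ)) * B4ContourShift.supNorm (x.1 - x'.1) ≤ (1 / (n : ℝ)) * ((n : ℝ) - 1) :=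
        mul_le_mul_of_nonneg_left (supNorm_sub_le_of_blk_eq hn h) (by positivity)
    _ ≤ 1 := by rw [div_mul_eq_mul_div, one_mul, div_le_one hn0]; linarith

/-! ## §2. The dictionary objects at `A = 0`: `Q_k^*δ_y = 1_{B^k(y)}`, the corner `L^ky`, and the three facts -/

/-- the standard boundary assignment of the B4 cell: `dist_η(supp f, Ω₀∖Ω)` (b04's default `zeroFieldSetting`).
[cite: Balaban1983RegularityDecay, Theorem p.573 (1.12), case A = 0] -/
def gStd : ∀ i : ZeroFieldInstance d, (↥i.R → ℝ) → ℝ := fun i f => bdist i.n i.hsub f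

/-- `y ∈ Ω^{(k)} = Π_j[0,M_j)` as a point of `T_η`: the base corner `L^k·y` of its block `B^k(y)` (I (1.17):
`B(y) = {x : y_μ ≦ x_μ < y_μ + L}`), a fine point of `Ω`. [cite: Balaban1982Higgs1, (1.17)–(1.20) p.607] -/
def corner (i : NestInst d ℓ m2plus) (y : ↥(boxDom i.M)) : ↥i.toZF.R :=
  ⟨fun j => (((ℓ + 1) ^ i.k : ℕ) : ℤ) * y.1 j, by
    have hy := (mem_boxDom (N := i.M)).1 y.2
    rw [NestInst.toZF_R, mem_boxDom]
    intro j
    obtain ⟨h0, h1⟩ := hy j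
    have hn : (0 : ℤ) < (((ℓ + 1) ^ i.k : ℕ) : ℤ) := by positivity
    refine ⟨mul_nonneg hn.le h0, ?_⟩
    push_cast
    exact mul_lt_mul_of_pos_left h1 hn⟩

/-- `Q_k^*δ_y` at `A = 0` (weight-1 adjoint, I (2.11)/(2.20)): the indicator of the block `B^k(y) = {x : ⌊x/L^k⌋ = y}`.
[cite: Balaban1982Higgs1, (2.11) p.609] -/
def blockInd (i : NestInst d ℓ m2plus) (y : ↥(boxDom i.M)) : ↥i.toZF.R → ℝ :=
  fun x => if blk ((ℓ + 1) ^ i.k) x.1 = y.1 then 1 else 0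

/-- the corner lies in its block: `1_{B^k(y)}(L^ky) = 1`. [folklore] -/
private theorem blockInd_corner (i : NestInst d ℓ m2plus) (y : ↥(boxDom i.M)) : blockInd i y (corner i y) = 1 := by
  have h : blk ((ℓ + 1) ^ i.k) (corner i y).1 = y.1 := blk_mul (BoxInst.one_le_Lk ℓ i.k) y.1
  simp [blockInd, h]

/-- the corner is in the support of `1_{B^k(y)}`. [folklore] -/
private theorem corner_mem_supp (i : NestInst d ℓ m2plus) (y : ↥(boxDom i.M)) : corner i y ∈ supp (blockInd i y) :=
  Finset.mem_filter.2 ⟨Finset.mem_univ _, by rw [blockInd_corner]; exact one_ne_zero⟩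

/-- the support of `1_{B^k(y)}` is inside the block of `y`. [folklore] -/
private theorem blk_eq_of_mem_supp (i : NestInst d ℓ m2plus) (y : ↥(boxDom i.M)) {x : ↥i.toZF.R}
    (hx : x ∈ supp (blockInd i y)) : blk ((ℓ + 1) ^ i.k) x.1 = y.1 := by
  have h := (Finset.mem_filter.1 hx).2
  by_contra hne
  exact h (by simp [blockInd, hne])

/-- `|1_{B^k(y)}| ≤ 1` pointwise. [folklore] -/
private theorem abs_blockInd_le (i : NestInst d ℓ m2plus) (y : ↥(boxDom i.M)) (x : ↥i.toZF.R) : |blockInd i y x| ≤ 1 := by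
  unfold blockInd
  split_ifs <;> simp

/-- **DICTIONARY FACT 1 at `A = 0`**: `‖Q_k^*δ_y‖_∞ ≤ 1` in the carrier's sup norm. [cite: Balaban1982Higgs2, Prop. 2.2 p.571] -/
theorem supNorm_blockInd_le (a : ℝ) (Mb : ℕ) (i : NestInst d ℓ m2plus) (y : ↥(boxDom i.M)) :
    (nestFamB ℓ m2plus a Mb gStd i).supNorm (blockInd i y) ≤ 1 :=
  supN_le_of_forall_le (i := i.toZF) _ zero_le_one (abs_blockInd_le i y)

/-- a point of `supp 1_{B^k(y)}` is within η-distance `1` of the corner `L^ky`. [folklore] -/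
private theorem edistR_corner_le_one (i : NestInst d ℓ m2plus) (y : ↥(boxDom i.M)) {x' : ↥i.toZF.R}
    (hx' : x' ∈ supp (blockInd i y)) : edistR ((ℓ + 1) ^ i.k) i.toZF.R x' (corner i y) ≤ 1 :=
  edistR_le_one_of_blk (BoxInst.one_le_Lk ℓ i.k) _ _
    ((blk_eq_of_mem_supp i y hx').trans (blk_mul (BoxInst.one_le_Lk ℓ i.k) y.1).symm)

/-- **DICTIONARY FACT 2 at `A = 0`**: `dist(x, y) ≤ dist(x, supp Q_k^*δ_y) + 1` (`y` = the corner `L^ky`, η-scaled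
sup-distances). [cite: Balaban1982Higgs2, Prop. 2.2 p.571] -/
theorem dxy_le_sdist (a : ℝ) (Mb : ℕ) (i : NestInst d ℓ m2plus) (x : ↥i.toZF.R) (y : ↥(boxDom i.M)) :
    edistR ((ℓ + 1) ^ i.k) i.toZF.R x (corner i y) ≤ (nestFamB ℓ m2plus a Mb gStd i).sdist1 x (blockInd i y) + 1 := by
  show _ ≤ setDist (edistR ((ℓ + 1) ^ i.k) i.toZF.R) {x} (supp (blockInd i y)) + 1
  have hne : (({x} : Finset ↥i.toZF.R) ×ˢ supp (blockInd i y)).Nonempty :=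
    ⟨(x, corner i y), Finset.mk_mem_product (Finset.mem_singleton_self x) (corner_mem_supp i y)⟩
  have h := le_setDist (edistR ((ℓ + 1) ^ i.k) i.toZF.R) hne
    (c := edistR ((ℓ + 1) ^ i.k) i.toZF.R x (corner i y) - 1) fun a ha b hb => by
      rw [Finset.mem_singleton.1 ha]
      have h1 := edistR_triangle (n := (ℓ + 1) ^ i.k) x b (corner i y)
      have h2 := edistR_corner_le_one i y hb
      linarith
  linarith

/-- **DICTIONARY FACT 3 at `A = 0`**: `dist(y, Ωᶜ) ≤ dist(supp Q_k^*δ_y, Ωᶜ) + 1` with the B4 cell's reading of the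
boundary distances (`dist_η(·, Ω₀∖Ω)`). [cite: Balaban1982Higgs2, Prop. 2.2 p.571] -/
theorem ydist_le_bdist (a : ℝ) (Mb : ℕ) (i : NestInst d ℓ m2plus) (y : ↥(boxDom i.M)) :
    (nestFamB ℓ m2plus a Mb gStd i).bdist1 (corner i y) ≤ (nestFamB ℓ m2plus a Mb gStd i).bdistS (blockInd i y) + 1 := by
  show setDist (edistR i.toZF.n i.toZF.R₀) {incl i.toZF.hsub (corner i y)} (outR i.toZF.R i.toZF.R₀)
      ≤ bdist i.toZF.n i.toZF.hsub (blockInd i y) + 1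
  by_cases hout : (outR i.toZF.R i.toZF.R₀).Nonempty
  · obtain ⟨z₀, hz₀⟩ := hout
    have hne : (((supp (blockInd i y)).map (inclEmb i.toZF.hsub)) ×ˢ outR i.toZF.R i.toZF.R₀).Nonempty :=
      ⟨(incl i.toZF.hsub (corner i y), z₀),
        Finset.mk_mem_product (Finset.mem_map_of_mem (inclEmb i.toZF.hsub) (corner_mem_supp i y)) hz₀⟩
    have h := le_setDist (edistR i.toZF.n i.toZF.R₀) hne
      (c := setDist (edistR i.toZF.n i.toZF.R₀) {incl i.toZF.hsub (corner i y)} (outR i.toZF.R i.toZF.R₀) - 1)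
      fun p hp z hz => by
        obtain ⟨x', hx', rfl⟩ := Finset.mem_map.1 hp
        have h1 : setDist (edistR i.toZF.n i.toZF.R₀) {incl i.toZF.hsub (corner i y)} (outR i.toZF.R i.toZF.R₀)
            ≤ edistR i.toZF.n i.toZF.R₀ (incl i.toZF.hsub (corner i y)) z :=
          setDist_le _ (Finset.mem_singleton_self _) hz
        have h2 := edistR_triangle (n := i.toZF.n) (incl i.toZF.hsub (corner i y)) (incl i.toZF.hsub x') z
        have h3 : edistR i.toZF.n i.toZF.R₀ (incl i.toZF.hsub (corner i y)) (incl i.toZF.hsub x') ≤ 1 := by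
          rw [edistR_incl, edistR_comm]
          exact edistR_corner_le_one i y hx'
        show _ ≤ edistR i.toZF.n i.toZF.R₀ (incl i.toZF.hsub x') z
        linarith
    show _ ≤ setDist (edistR i.toZF.n i.toZF.R₀) ((supp (blockInd i y)).map (inclEmb i.toZF.hsub))
        (outR i.toZF.R i.toZF.R₀) + 1
    linarith
  · rw [Finset.not_nonempty_iff_eq_empty.1 hout, setDist_empty_right]
    show (0 : ℝ) ≤ bdist i.toZF.n i.toZF.hsub (blockInd i y) + 1
    unfold bdist
    rw [Finset.not_nonempty_iff_eq_empty.1 hout, setDist_empty_right]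
    norm_num

/-! ## §3. The model instance and Proposition 2.2 on it -/

/-- **THE CONCRETE DICTIONARY AT `A = 0` ON THE NESTED BOXES.**  Member `i` (scale `k ≥ 1`, `η = L^{−k}`, `L = ℓ + 1`,
box `Ω = Π_j[0,M_j)`, outer box `Ω₀`, mass `m²`, charge `e`): the Prop. I.2.1 instance is b04's verbatim zero-field
carrier `nestFamB … i` with the standard boundary assignment; `y ∈ Π_j[0,M_j) ∩ ℤ^{d+1}`; bonds `(b₋, μ)`, read at
`b₋`; one test vector; `f_y = 1_{B^k(y)} = Q_k^*δ_y`; `dist(x,y) = η|x − L^ky|_∞`, `dist(b,y) = dist(b₋,y)`,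
`dist(b,Ωᶜ) = dist(b₋,Ωᶜ)`, `dist(y,Ωᶜ) = dist_η(L^ky, Ω₀∖Ω)`; allowance `D = 1`.
[cite: Balaban1982Higgs2, Prop. 2.2 (2.58) pp.570–571] -/
def zeroDict (ℓ : ℕ) (m2plus a : ℝ) (Mb : ℕ) (i : NestInst d ℓ m2plus) : Dict 1 where
  S := nestFamB ℓ m2plus a Mb gStd i
  KSite := ↥(boxDom i.M)
  Bond := ↥i.toZF.R × Fin (d + 1)
  base := Prod.fst
  dir := Prod.snd
  hDir := ⟨(0 : Fin (d + 1))⟩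
  V := Unit
  hV := ⟨()⟩
  src := fun y _ => blockInd i y
  dxy := fun x y => edistR ((ℓ + 1) ^ i.k) i.toZF.R x (corner i y)
  dby := fun b y => edistR ((ℓ + 1) ^ i.k) i.toZF.R b.1 (corner i y)
  bdistB := fun b => (nestFamB ℓ m2plus a Mb gStd i).bdist1 b.1
  ydist := fun y => (nestFamB ℓ m2plus a Mb gStd i).bdist1 (corner i y)
  supNorm_src := fun y _ => supNorm_blockInd_le a Mb i y
  dxy_le := fun x y _ => dxy_le_sdist a Mb i x y
  ydist_le := fun y _ => ydist_le_bdist a Mb i y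
  dby_le := fun _ _ => le_rfl
  bdistB_le := fun _ => le_rfl

/-- **PROPOSITION 2.2 (2.58), r14's decl of record, HOLDS WITH NO HYPOTHESIS on the zero-field nested-box dictionary
family** (every `L ≥ 2`, `a > 0`, mass window `[0, m²₊]`, big-block size `Mb`): from the B4 cell's α = 0 clause of
the Theorem p. 573 (= Prop. I.2.1) on `nestFamB` (`ineq_zero_nestFamB`, pv17) through §1.  The antecedents `regular`,
`bigBlocks`, `0 < e ≤ e₁` of the typed statement are not used (`R₀ = e₁ = 1`). [cite: Balaban1982Higgs2, Prop. 2.2 (2.58) pp.570–571] -/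
theorem prop22Printed_zero_nestFam (hℓ : 1 ≤ ℓ) {a : ℝ} (ha : 0 < a) (Mb : ℕ) :
    B2StepK.Prop22Printed (fun i : NestInst d ℓ m2plus => (zeroDict ℓ m2plus a Mb i).toP22) := by
  obtain ⟨δ₀, c₀, hδ, hc, h⟩ :=
    ineq_zero_nestFamB (d := d) (m2plus := m2plus) hℓ ha Mb (g := gStd) (fun _ _ _ _ => le_rfl)
  exact prop22Printed_of_B4clause zero_le_one _ 0 ⟨δ₀, c₀, 1, 1, hδ, hc, one_pos, one_pos, fun i _ _ _ _ => h 1 i⟩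

/-- Reading aid: the linked kernel `|(G_k(Ω,0)Q_k^*)(x,y)|` of the zero-field dictionary IS
`|Σ_{x′ ∈ B^k(y)} G_k(Ω,0;x,x′)| = |(G_k(Ω,0)1_{B^k(y)})(x)|` (`G_k(Ω,0)` = b04's `green` = `(−Δ^{η,N}_Ω + m² + aP_k)⁻¹`).
[cite: Balaban1982Higgs2, Prop. 2.2 (2.58) pp.570–571] -/
theorem kGQ_zeroDict (a : ℝ) (Mb : ℕ) (i : NestInst d ℓ m2plus) (x : ↥i.toZF.R) (y : ↥(boxDom i.M)) :
    (zeroDict ℓ m2plus a Mb i).toP22.kGQ x y = |(i.toZF.green a).mulVec (blockInd i y) x| := by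
  show (⨆ _ : Unit, |(i.toZF.green a).mulVec (blockInd i y) x|) = _
  exact ciSup_const

/-- **(2.58) FOR `G_k(Ω,0)Q_k^*` ON THE NESTED BOXES, EXPLICIT FORM** (no hypothesis, no restriction on the point: the
B4 cell's clause holds for every threshold `R₀`): one pair `δ₀, c₀ > 0` with
`|Σ_{x′∈B^k(y)} G_k(Ω,0;x,x′)| ≤ c₀e^{−δ₀η|x − L^ky|_∞}` for every member, every `x ∈ Ω`, every `y ∈ Ω^{(k)}`.
[cite: Balaban1982Higgs2, Prop. 2.2 (2.58) pp.570–571] -/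
theorem GQ_decay_zero_nestFam (hℓ : 1 ≤ ℓ) {a : ℝ} (ha : 0 < a) (Mb : ℕ) :
    ∃ δ₀ c₀ : ℝ, 0 < δ₀ ∧ 0 < c₀ ∧ ∀ (i : NestInst d ℓ m2plus) (x : ↥i.toZF.R) (y : ↥(boxDom i.M)),
      |(i.toZF.green a).mulVec (blockInd i y) x| ≤
        c₀ * Real.exp (-(δ₀ * edistR ((ℓ + 1) ^ i.k) i.toZF.R x (corner i y))) := by
  obtain ⟨δ₀, c₀, hδ, hc, h⟩ :=
    ineq_zero_nestFamB (d := d) (m2plus := m2plus) hℓ ha Mb (g := gStd) (fun _ _ _ _ => le_rfl)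
  refine ⟨δ₀, c₀ * Real.exp (2 * δ₀ * 1), hδ, by positivity, fun i x y => ?_⟩
  have h1 := ((h ((nestFamB ℓ m2plus a Mb gStd i).bdist1 x) i).1.2 (0 : Fin (d + 1)) (blockInd i y) x
    (Or.inr le_rfl)).2
  exact bound_plain hc.le hδ.le zero_le_one h1 (supNorm_blockInd_le a Mb i y) (dxy_le_sdist a Mb i x y)

end

end Literature.MathematicalPhysics.QuantumFieldTheory.Balaban1983to89.B2Prop22ZeroField
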